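import Summits.Ventures.HodgeRepro2.T5SU11PhaseLawLintegral

/-!
# The law of the phase for measurable functions, and the tail `P(log|a| > x) = e^{−(k−2)x}`

`T5SU11PhaseLawLintegral` proved the law of the phase for continuous `F`; the continuity was used only
through the polar-coordinate lemma of `T5BergmanParseval`. Re-proving that lemma for MEASURABLE
`[0, ∞]`-valued functions (`lintegral_ball_eq_polar'`, from Mathlib's `Complex.lintegral_comp_polarCoord_symm`
and Tonelli) gives the law for every measurable `G : ℝ → [0, ∞]`:

  **`∫⁻_G G(log|a(g)|) dν = 2π · ∫⁻_0^∞ G(s) e^{2s} ds`**   (`lintegral_phase_eq_measurable`),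

and, with `G` the indicator of `(x, ∞)` times `e^{−ks}`, the **tail of the phase under `m_k dν`**:

  **`∫⁻_{log|a(g)| > x} (1 − |g·0|²)^{k/2} dν = 2π e^{−(k−2)x}/(k − 2)`**   (`lintegral_phase_tail`, `k > 2`, `x ≥ 0`),

i.e. `P_{k}(log|a| > x) = e^{−(k−2)x}` for the probability measure `(k − 2)/(2π) · m_k dν`
(`phase_tail_prob`): the phase is exponentially distributed with rate `k − 2`, in distribution and not
only in moments. Nothing is claimed about (N).

Blind lane: Mathlib + the HodgeRepro2 prefix only; no sorry; axioms ⊆ {propext, Classical.choice,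
Quot.sound}.
-/

namespace Summit.Ventures.HodgeRepro2.T5SU11PhaseTail

open MeasureTheory MeasureTheory.Measure Metric Set Filter Topology
open T5PoincareMeasure T5SU11Unimodular T5SU11Fibration T5SU11Cartan T5SU11CartanProjection
  T5SU11FibrationCartan T5HaarCircle T5BergmanCoefficient T5BergmanParseval T5SU11FibrationHaar
  T5SU11SphericalFunction T5SU11SphericalSymmetry T5SU11JacobiIwasawa T5SU11JacobiTransform
  T5SU11JacobiWeight T5SU11PhaseLaw T5SU11PhaseLawLintegral
open scoped Real ENNReal

/-! ### Polar coordinates for measurable `[0, ∞]`-valued functions -/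

/-- **The disc `lintegral` in polar coordinates, Tonelli form, for measurable `G : ℂ → [0, ∞]`**:
`∫⁻_𝔻 G = ∫⁻_{r∈(0,1)} ∫⁻_{θ∈(-π,π)} r · G(r e^{iθ})`. -/
theorem lintegral_ball_eq_polar' (G : ℂ → ℝ≥0∞) (hG : Measurable G) :
    ∫⁻ z in ball (0 : ℂ) 1, G z
      = ∫⁻ r in Ioo (0 : ℝ) 1, ∫⁻ θ in Ioo (-π) π, ENNReal.ofReal r * G (circleMap 0 r θ) := by
  set H : ℂ → ℝ≥0∞ := (ball (0 : ℂ) 1).indicator G with hH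
  have key := Complex.lintegral_comp_polarCoord_symm H
  rw [hH, lintegral_indicator measurableSet_ball] at key
  rw [← key, polarCoord_target]
  have e : ∀ q ∈ Ioi (0 : ℝ) ×ˢ Ioo (-π) π,
      ENNReal.ofReal q.1 • (ball (0 : ℂ) 1).indicator G (Complex.polarCoord.symm q)
        = (Ioo (0 : ℝ) 1 ×ˢ Ioo (-π) π).indicator
            (fun q : ℝ × ℝ => ENNReal.ofReal q.1 * G (circleMap 0 q.1 q.2)) q := by
    rintro ⟨r, θ⟩ ⟨hr, hθ⟩
    simp only [mem_Ioi] at hr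
    rw [polarCoord_symm_eq_circleMap]
    have hn : ‖circleMap 0 r θ‖ = r := by rw [norm_circleMap_zero, abs_of_pos hr]
    by_cases h1 : r < 1
    · have hmem : circleMap 0 r θ ∈ ball (0 : ℂ) 1 := by rw [mem_ball_zero_iff, hn]; exact h1
      rw [indicator_of_mem hmem, indicator_of_mem
        (show (r, θ) ∈ Ioo (0 : ℝ) 1 ×ˢ Ioo (-π) π from ⟨⟨hr, h1⟩, hθ⟩), smul_eq_mul]
    · have hmem : circleMap 0 r θ ∉ ball (0 : ℂ) 1 := by rw [mem_ball_zero_iff, hn]; exact h1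
      rw [indicator_of_notMem hmem, indicator_of_notMem
        (show (r, θ) ∉ Ioo (0 : ℝ) 1 ×ˢ Ioo (-π) π from fun h => h1 h.1.2), smul_zero]
  rw [setLIntegral_congr_fun (measurableSet_Ioi.prod measurableSet_Ioo) e,
    lintegral_indicator (measurableSet_Ioo.prod measurableSet_Ioo),
    Measure.restrict_restrict (measurableSet_Ioo.prod measurableSet_Ioo),
    inter_eq_left.mpr (Set.prod_mono Ioo_subset_Ioi_self le_rfl)]
  have hmeas : AEMeasurable (fun q : ℝ × ℝ => ENNReal.ofReal q.1 * G (circleMap 0 q.1 q.2))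
      (volume.restrict (Ioo (0 : ℝ) 1 ×ˢ Ioo (-π) π)) :=
    (measurable_fst.ennreal_ofReal.mul (hG.comp continuous_pol.measurable)).aemeasurable
  rw [Measure.volume_eq_prod, ← Measure.prod_restrict] at hmeas ⊢
  exact lintegral_prod _ hmeas

section measure

variable [MeasurableSpace Circle] [BorelSpace Circle]

/-! ### The law of the phase for measurable functions -/

/-- **THE LAW OF THE PHASE for measurable `G : ℝ → [0, ∞]`**:
`∫⁻_G G(log|a(g)|) dν = 2π · ∫⁻_0^∞ G(s) e^{2s} ds`. -/
theorem lintegral_phase_eq_measurable (G : ℝ → ℝ≥0∞) (hG : Measurable G) :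
    ∫⁻ g, G (Real.log ‖mat g 0 0‖) ∂(nu haarCircle)
      = ENNReal.ofReal (2 * π) * ∫⁻ s in Ioi (0 : ℝ), G s * ENNReal.ofReal (Real.exp (2 * s)) := by
  have hmeas : Measurable fun g : SU11 => G (Real.log ‖mat g 0 0‖) :=
    hG.comp T5SU11JacobiWeightDeriv.continuous_log_norm_mat.measurable
  rw [lintegral_nu_of_right_rot_invariant _ hmeas (fun g u => by rw [log_norm_mat_mul_rot])]
  have e1 : ∫⁻ z in ball (0 : ℂ) 1, ENNReal.ofReal (dens z) * G (Real.log ‖mat (sec z) 0 0‖)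
      = ∫⁻ z in ball (0 : ℂ) 1, ENNReal.ofReal (dens z) * G (-(1 / 2) * Real.log (1 - ‖z‖ ^ 2)) := by
    refine setLIntegral_congr_fun measurableSet_ball fun z hz => ?_
    rw [log_norm_mat_sec hz]
  rw [e1]
  have hGm : Measurable fun z : ℂ => ENNReal.ofReal (dens z) * G (-(1 / 2) * Real.log (1 - ‖z‖ ^ 2)) := by
    refine measurable_dens.ennreal_ofReal.mul (hG.comp ?_)
    exact (measurable_const.mul ((measurable_const.sub (continuous_norm.measurable.pow_const 2)).log))
  rw [lintegral_ball_eq_polar' _ hGm]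
  have e2 : ∀ r ∈ Ioo (0 : ℝ) 1,
      ∫⁻ θ in Ioo (-π) π, ENNReal.ofReal r * (ENNReal.ofReal (dens (circleMap 0 r θ))
        * G (-(1 / 2) * Real.log (1 - ‖circleMap 0 r θ‖ ^ 2)))
      = ENNReal.ofReal (2 * π) * (ENNReal.ofReal (r / (1 - r ^ 2) ^ 2)
          * G (-(1 / 2) * Real.log (1 - r ^ 2))) := by
    intro r hr
    have hn : ∀ θ, ‖circleMap 0 r θ‖ = r := fun θ => by
      rw [norm_circleMap_zero, abs_of_pos hr.1]
    have e : ∀ θ, ENNReal.ofReal r * (ENNReal.ofReal (dens (circleMap 0 r θ))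
        * G (-(1 / 2) * Real.log (1 - ‖circleMap 0 r θ‖ ^ 2)))
        = ENNReal.ofReal (r / (1 - r ^ 2) ^ 2) * G (-(1 / 2) * Real.log (1 - r ^ 2)) := fun θ => by
      rw [dens_eq_norm, hn, ← mul_assoc, ← ENNReal.ofReal_mul hr.1.le]
      congr 2
      ring
    simp_rw [e]
    rw [lintegral_const, Measure.restrict_apply MeasurableSet.univ, univ_inter, Real.volume_Ioo,
      mul_comm]
    congr 2
    ring
  have hm : Measurable fun r : ℝ =>
      ENNReal.ofReal (r / (1 - r ^ 2) ^ 2) * G (-(1 / 2) * Real.log (1 - r ^ 2)) := by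
    have h1 : Measurable fun r : ℝ => 1 - r ^ 2 := measurable_const.sub (measurable_id.pow_const 2)
    exact ((measurable_id.div (h1.pow_const 2)).ennreal_ofReal).mul
      (hG.comp (measurable_const.mul h1.log))
  rw [setLIntegral_congr_fun measurableSet_Ioo e2, lintegral_const_mul _ hm]
  congr 1
  rw [lintegral_Ioi_comp_radial (fun s => G s * ENNReal.ofReal (Real.exp (2 * s)))]
  refine setLIntegral_congr_fun measurableSet_Ioo fun r hr => ?_
  have h0 : 0 < 1 - r ^ 2 := by nlinarith [hr.1, hr.2]
  have hd : 0 < r / (1 - r ^ 2) := div_pos hr.1 h0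
  have e3 : Real.exp (2 * (-(1 / 2) * Real.log (1 - r ^ 2))) = (1 - r ^ 2)⁻¹ := by
    rw [show 2 * (-(1 / 2) * Real.log (1 - r ^ 2)) = -Real.log (1 - r ^ 2) by ring, Real.exp_neg,
      Real.exp_log h0]
  rw [abs_of_pos hd, e3, mul_comm (G _), ← mul_assoc, ← ENNReal.ofReal_mul hd.le]
  congr 2
  field_simp

/-! ### The tail of the phase under `m_k dν` -/

/-- **The tail**: for `k > 2` and `x ≥ 0`,
`∫⁻_{log|a(g)| > x} (1 − |g·0|²)^{k/2} dν = 2π e^{−(k−2)x}/(k − 2)`. -/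
theorem lintegral_phase_tail {k x : ℝ} (hk : 2 < k) (hx : 0 ≤ x) :
    ∫⁻ g, {g : SU11 | x < Real.log ‖mat g 0 0‖}.indicator
        (fun g => ENNReal.ofReal ((1 - ‖orbit g‖ ^ 2) ^ (k / 2))) g ∂(nu haarCircle)
      = ENNReal.ofReal (2 * π * Real.exp (-((k - 2) * x)) / (k - 2)) := by
  set G : ℝ → ℝ≥0∞ := (Ioi x).indicator fun s => ENNReal.ofReal (Real.exp (-(k * s))) with hGdef
  have hG : Measurable G :=
    (ENNReal.measurable_ofReal.comp (Real.continuous_exp.measurable.comp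
      (measurable_const.mul measurable_id).neg)).indicator measurableSet_Ioi
  have e : ∀ g : SU11, {g : SU11 | x < Real.log ‖mat g 0 0‖}.indicator
      (fun g => ENNReal.ofReal ((1 - ‖orbit g‖ ^ 2) ^ (k / 2))) g = G (Real.log ‖mat g 0 0‖) := by
    intro g
    simp only [hGdef, indicator, mem_setOf_eq, mem_Ioi]
    split_ifs with h
    · rw [orbit_rpow_eq_exp]
    · rfl
  simp_rw [e]
  rw [lintegral_phase_eq_measurable G hG]
  have e2 : ∀ s ∈ Ioi (0 : ℝ), G s * ENNReal.ofReal (Real.exp (2 * s))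
      = (Ioi x).indicator (fun s => ENNReal.ofReal (Real.exp (-((k - 2) * s)))) s := by
    intro s _
    simp only [hGdef, indicator]
    split_ifs with h
    · rw [← ENNReal.ofReal_mul (Real.exp_pos _).le, ← Real.exp_add]
      congr 2
      ring
    · rw [zero_mul]
  rw [setLIntegral_congr_fun measurableSet_Ioi e2, lintegral_indicator measurableSet_Ioi,
    Measure.restrict_restrict measurableSet_Ioi, inter_eq_left.mpr (Ioi_subset_Ioi hx)]
  have hk2 : 0 < k - 2 := by linarith
  have hint : IntegrableOn (fun s : ℝ => Real.exp (-((k - 2) * s))) (Ioi x) := by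
    have := exp_neg_integrableOn_Ioi x hk2
    refine this.congr_fun (fun s _ => ?_) measurableSet_Ioi
    ring_nf
  rw [← ofReal_integral_eq_lintegral_ofReal hint ((ae_restrict_iff' measurableSet_Ioi).mpr
    (ae_of_all _ fun s _ => (Real.exp_pos _).le)), ← ENNReal.ofReal_mul (by positivity)]
  congr 1
  have e3 : ∀ s : ℝ, Real.exp (-((k - 2) * s)) = Real.exp (-(k - 2) * s) := fun s => by ring_nf
  simp_rw [e3]
  rw [integral_exp_mul_Ioi (by linarith) x]
  field_simp

/-- **`P_k(log|a| > x) = e^{−(k−2)x}`**: the tail divided by the mass `2π/(k − 2)`. -/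
theorem phase_tail_prob {k x : ℝ} (hk : 2 < k) (hx : 0 ≤ x) :
    (∫⁻ g, {g : SU11 | x < Real.log ‖mat g 0 0‖}.indicator
        (fun g => ENNReal.ofReal ((1 - ‖orbit g‖ ^ 2) ^ (k / 2))) g ∂(nu haarCircle))
      / ENNReal.ofReal (2 * π / (k - 2)) = ENNReal.ofReal (Real.exp (-((k - 2) * x))) := by
  rw [lintegral_phase_tail hk hx, ← ENNReal.ofReal_div_of_pos (by positivity)]
  congr 1
  have hk2 : k - 2 ≠ 0 := by
    intro h
    linarith
  field_simp

end measure

end Summit.Ventures.HodgeRepro2.T5SU11PhaseTail
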